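import Summits.Ventures.HSemireg.WedgeHankelNodeImagesLow

/-!
# Venture HSemireg — THE BOOLEAN LATTICE OF DIVISOR KERNELS IN EVERY DEGREE: for two divisors with DISJOINT node sets and total orders `D_A + D_B ≤ k + 1` the node-kernel intersections are
# complementary sums, `(⋂_A Kr) + (⋂_B Kr) = Hom(univ, k)` — every degree-`k` form splits as (one killing all nodes of `A`) + (one killing all nodes of `B`); union ↦ intersection,
# `D_A + D_B ≥ k + 1` ↦ `⋂_A ⊓ ⋂_B = SI_k` — D9 §4 for confluent divisors, without `r + s ≤ n + 1 − k`

HONEST FRAMING. Part of the Lean index of the computation cell `pub-hsemireg` (seat p10 gen 17, Sunday typer «UNIFORM-IN-n»).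
Finite-dimensional EXTERIOR ALGEBRA over a field ONLY: no variety, no cohomology theory, no sheaf, no Ext group, no semiregularity map;
nothing here says that HC / HC_CM / HC_AV holds; no Literature fact is declared or used.  Custodian versions as in `WedgeHankelSiegelIdeal` (1/3) and
`WedgeKernelDuality`; the dictionary (node classes, divisors `Σ_i (P_i+1)[λ_i]`) is QUOTED, never asserted.

WHAT IS IN THE TREE.  D9 `iInf_frameIdeal_sup_iInf_frameIdeal_eq_Hom` (gen 14: simple nodes, `r + s ≤ min(k+1, m+1−k)`), E1 (`Ann_inf`, `Ann_bot`), G3 (`Ann_iSup_V_w_eq_iInf_Kr`), G4 (any divisor of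
total order `≥ k + 1` cuts out `SI_k`), G8 (this seat: node images of ANY divisor with `D ≤ k + 1` are in general position in every degree, `finrank_iSup_V_w_expMul_eq`).  THIS FILE glues two
divisors (namespace `Summit.Ventures.HSemireg.Wedge.KernelDuality` continued; imports G8):
* §115 APPENDING two node families (`Fin.append`): `iSup_V_append`, `iInf_Kr_append`, `sum_order_append` (bookkeeping over `Fin (r + s)`).
* §116 **`disjoint_iSup_V_w_expMul_of_disjoint`**: the image sums of two divisors with disjoint node sets and `D_A + D_B ≤ k + 1` (orders `≤ k′`, `k + k′ = n`) meet in `0` (G8's count for `A`,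
  `B` and `A ∪ B`); **`iInf_Kr_sup_iInf_Kr_eq_Hom`: `(⋂_A Kr(node, k)) ⊔ (⋂_B Kr(node, k)) = Hom(univ, k)`** (`k + P ≤ n`; E1's `Ann_inf` + `Ann_bot`) — every degree-`k` form is a sum of
  a form killing every node of `A` and a form killing every node of `B`; `exists_add_eq_of_mem_Hom'`.
* §117 **`iInf_Kr_inf_iInf_Kr_eq_siegelIdeal`**: for `D_A + D_B ≥ k + 1` (disjoint node sets, `k + P ≤ n`) `(⋂_A Kr) ⊓ (⋂_B Kr) = SI_k` (G4 on `A ∪ B`); so at `D_A + D_B = k + 1` the two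
  intersections are COMPLEMENTS modulo `SI_k` (`iInf_Kr_isCompl_mod_siegelIdeal`).
NOT typed here: nodes at `∞`; anything Ext-side.  Class side only; new names only.
-/

open Module

namespace Summit.Ventures.HSemireg.Wedge.KernelDuality

open Summit.Ventures.HSemireg.Wedge Summit.Ventures.HSemireg.Wedge.Kunneth Summit.Ventures.HSemireg.Wedge.Hankel
  Summit.Ventures.HSemireg.Wedge.HankelSiegel Summit.Ventures.HSemireg.Wedge.HankelSiegelIdeal Summit.Ventures.HSemireg.Wedge.KunnethKernel
  Summit.Ventures.HSemireg.Wedge.HankelSecant Summit.Ventures.HSemireg.Wedge.HankelFrameChange Summit.Ventures.HSemireg.Wedge.HankelPureKernel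

variable (K : Type*) [Field K] {n : ℕ}

/-! ## §115. Appending two node families -/

section Append

variable {M : Type*} [CompleteLattice M]

/-- a supremum over `Fin (r + s)` splits into the two halves. -/
lemma iSup_fin_add_eq {r s : ℕ} (F : Fin (r + s) → M) : (⨆ i, F i) = (⨆ i : Fin r, F (Fin.castAdd s i)) ⊔ ⨆ j : Fin s, F (Fin.natAdd r j) := by
  rw [← (finSumFinEquiv (m := r) (n := s)).surjective.iSup_comp, iSup_sum]
  simp only [finSumFinEquiv_apply_left, finSumFinEquiv_apply_right]

/-- an infimum over `Fin (r + s)` splits into the two halves. -/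
lemma iInf_fin_add_eq {r s : ℕ} (F : Fin (r + s) → M) : (⨅ i, F i) = (⨅ i : Fin r, F (Fin.castAdd s i)) ⊓ ⨅ j : Fin s, F (Fin.natAdd r j) := by
  rw [← (finSumFinEquiv (m := r) (n := s)).surjective.iInf_comp, iInf_sum]
  simp only [finSumFinEquiv_apply_left, finSumFinEquiv_apply_right]

end Append

/-- the image sum of an appended family is the sup of the two image sums. -/
lemma iSup_V_append {r s : ℕ} (lam : Fin r → K) (nu : Fin s → K) (q : Fin r → ℕ → K) (q' : Fin s → ℕ → K) (a : ℕ) :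
    (⨆ i : Fin (r + s), V K (In n) Finset.univ (w K n n (expMul K (Fin.append lam nu i) (Fin.append q q' i))) a) =
      (⨆ i, V K (In n) Finset.univ (w K n n (expMul K (lam i) (q i))) a) ⊔ ⨆ j, V K (In n) Finset.univ (w K n n (expMul K (nu j) (q' j))) a := by
  rw [iSup_fin_add_eq]; simp only [Fin.append_left, Fin.append_right]

/-- the kernel intersection of an appended family is the inf of the two kernel intersections. -/
lemma iInf_Kr_append {r s : ℕ} (lam : Fin r → K) (nu : Fin s → K) (q : Fin r → ℕ → K) (q' : Fin s → ℕ → K) (a : ℕ) :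
    (⨅ i : Fin (r + s), Kr K Finset.univ (w K n n (expMul K (Fin.append lam nu i) (Fin.append q q' i))) a) =
      (⨅ i, Kr K Finset.univ (w K n n (expMul K (lam i) (q i))) a) ⊓ ⨅ j, Kr K Finset.univ (w K n n (expMul K (nu j) (q' j))) a := by
  rw [iInf_fin_add_eq]; simp only [Fin.append_left, Fin.append_right]

/-- total orders add. -/
lemma sum_order_append {r s : ℕ} (P : Fin r → ℕ) (P' : Fin s → ℕ) : ∑ i : Fin (r + s), (Fin.append P P' i + 1) = (∑ i, (P i + 1)) + ∑ j, (P' j + 1) := by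
  rw [Fin.sum_univ_add]; simp only [Fin.append_left, Fin.append_right]

/-- exact-order data of an appended family. -/
lemma append_order_zero {r s : ℕ} {P : Fin r → ℕ} {P' : Fin s → ℕ} {q : Fin r → ℕ → K} {q' : Fin s → ℕ → K} (hq : ∀ i j, P i < j → q i j = 0) (hq' : ∀ i j, P' i < j → q' i j = 0) :
    ∀ (i : Fin (r + s)) (j : ℕ), Fin.append P P' i < j → Fin.append q q' i j = 0 := fun i =>
  Fin.addCases (fun i j hj => by rw [Fin.append_left] at hj ⊢; exact hq i j hj) (fun i j hj => by rw [Fin.append_right] at hj ⊢; exact hq' i j hj) i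

/-- exact-order data of an appended family (leading coefficients). -/
lemma append_order_ne {r s : ℕ} {P : Fin r → ℕ} {P' : Fin s → ℕ} {q : Fin r → ℕ → K} {q' : Fin s → ℕ → K} (hqP : ∀ i, q i (P i) ≠ 0) (hqP' : ∀ i, q' i (P' i) ≠ 0) :
    ∀ i : Fin (r + s), Fin.append q q' i (Fin.append P P' i) ≠ 0 := fun i =>
  Fin.addCases (fun i => by rw [Fin.append_left, Fin.append_left]; exact hqP i) (fun i => by rw [Fin.append_right, Fin.append_right]; exact hqP' i) i

/-- pointwise bounds of an appended family. -/
lemma append_le {r s : ℕ} {P : Fin r → ℕ} {P' : Fin s → ℕ} {b : ℕ} (hP : ∀ i, P i ≤ b) (hP' : ∀ i, P' i ≤ b) : ∀ i : Fin (r + s), Fin.append P P' i ≤ b := fun i =>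
  Fin.addCases (fun i => by rw [Fin.append_left]; exact hP i) (fun i => by rw [Fin.append_right]; exact hP' i) i

/-! ## §116. Disjoint divisors: the image sums are independent, the kernel intersections are complementary sums -/

/-- **TWO DIVISORS WITH DISJOINT NODE SETS AND `D_A + D_B ≤ k + 1` HAVE INDEPENDENT IMAGE SUMS**: `Disjoint (⨆_A V(node, k′)) (⨆_B V(node, k′))` (distinct nodes, exact orders `≤ k′`,
`k + k′ = n`) — G8's dimension count for `A`, `B` and `A ∪ B`. -/
theorem disjoint_iSup_V_w_expMul_of_disjoint {k k' r s : ℕ} (hkk' : k + k' = n) {lam : Fin r → K} (hlam : Function.Injective lam) {nu : Fin s → K} (hnu : Function.Injective nu)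
    (hdis : ∀ i j, lam i ≠ nu j) {P : Fin r → ℕ} {q : Fin r → ℕ → K} (hq : ∀ i j, P i < j → q i j = 0) (hqP : ∀ i, q i (P i) ≠ 0) (hPk' : ∀ i, P i ≤ k')
    {P' : Fin s → ℕ} {q' : Fin s → ℕ → K} (hq' : ∀ i j, P' i < j → q' i j = 0) (hqP' : ∀ i, q' i (P' i) ≠ 0) (hP'k' : ∀ i, P' i ≤ k')
    (hD : (∑ i, (P i + 1)) + ∑ j, (P' j + 1) ≤ k + 1) :
    Disjoint (⨆ i, V K (In n) Finset.univ (w K n n (expMul K (lam i) (q i))) k') (⨆ j, V K (In n) Finset.univ (w K n n (expMul K (nu j) (q' j))) k') := by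
  have happ : Function.Injective (Fin.append lam nu) := Fin.append_injective_iff.mpr ⟨hlam, hnu, hdis⟩
  have hU := finrank_iSup_V_w_expMul_eq K hkk' happ (append_order_zero K hq hq') (append_order_ne K hqP hqP') (append_le hPk' hP'k')
    (by rw [sum_order_append]; exact hD)
  rw [iSup_V_append, sum_order_append, Nat.add_mul] at hU
  have hA := finrank_iSup_V_w_expMul_eq K hkk' hlam hq hqP hPk' (by omega)
  have hB := finrank_iSup_V_w_expMul_eq K hkk' hnu hq' hqP' hP'k' (by omega)
  have h := Submodule.finrank_sup_add_finrank_inf_eq (⨆ i, V K (In n) Finset.univ (w K n n (expMul K (lam i) (q i))) k')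
    (⨆ j, V K (In n) Finset.univ (w K n n (expMul K (nu j) (q' j))) k')
  rw [hU, hA, hB] at h
  have h0 : finrank K ↥((⨆ i, V K (In n) Finset.univ (w K n n (expMul K (lam i) (q i))) k') ⊓ ⨆ j, V K (In n) Finset.univ (w K n n (expMul K (nu j) (q' j))) k') = 0 := by
    omega
  rw [disjoint_iff, Submodule.finrank_eq_zero.mp h0]

/-- **COMPLEMENTARY SUMS: `(⋂_A Kr(univ, node, k)) ⊔ (⋂_B Kr(univ, node, k)) = Hom(univ, k)`** for two divisors with disjoint node sets, distinct nodes each, exact orders with `k + P ≤ n`, at least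
one node each, and `D_A + D_B ≤ k + 1` — EVERY degree-`k` form is (a form killing every node of `A`) + (a form killing every node of `B`); D9's `r + s ≤ n + 1 − k` is gone. -/
theorem iInf_Kr_sup_iInf_Kr_eq_Hom {k r s : ℕ} {lam : Fin r → K} (hlam : Function.Injective lam) {nu : Fin s → K} (hnu : Function.Injective nu) (hdis : ∀ i j, lam i ≠ nu j)
    {P : Fin r → ℕ} {q : Fin r → ℕ → K} (hq : ∀ i j, P i < j → q i j = 0) (hqP : ∀ i, q i (P i) ≠ 0) (hkP : ∀ i, k + P i ≤ n)
    {P' : Fin s → ℕ} {q' : Fin s → ℕ → K} (hq' : ∀ i j, P' i < j → q' i j = 0) (hqP' : ∀ i, q' i (P' i) ≠ 0) (hkP' : ∀ i, k + P' i ≤ n)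
    (hD : (∑ i, (P i + 1)) + ∑ j, (P' j + 1) ≤ k + 1) (hr : 0 < r) (hs : 0 < s) :
    (⨅ i, Kr K Finset.univ (w K n n (expMul K (lam i) (q i))) k) ⊔ (⨅ j, Kr K Finset.univ (w K n n (expMul K (nu j) (q' j))) k) = Hom K (In n) Finset.univ k := by
  have hk : k ≤ n := by have := hkP ⟨0, hr⟩; omega
  have hkk' : k + (n - k) = n := by omega
  rw [← Ann_iSup_V_w_eq_iInf_Kr K hkk' hr, ← Ann_iSup_V_w_eq_iInf_Kr K hkk' hs,
    ← Ann_inf K (a := k) (b := n - k + n) (by rw [Fintype.card_fin]; omega)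
      (iSup_le fun i => (V_w_le_coSiegel K hkk' _).trans (coSiegel_le_Hom K _)) (iSup_le fun j => (V_w_le_coSiegel K hkk' _).trans (coSiegel_le_Hom K _)),
    disjoint_iff.mp (disjoint_iSup_V_w_expMul_of_disjoint K hkk' hlam hnu hdis hq hqP (fun i => by have := hkP i; omega) hq' hqP' (fun i => by have := hkP' i; omega) hD),
    Ann_bot]

/-- element form: every `θ ∈ ⋀^k` is `θ_A + θ_B` with `θ_A` killing every node class of `A` and `θ_B` every node class of `B`. -/
theorem exists_add_eq_of_mem_Hom' {k r s : ℕ} {lam : Fin r → K} (hlam : Function.Injective lam) {nu : Fin s → K} (hnu : Function.Injective nu) (hdis : ∀ i j, lam i ≠ nu j)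
    {P : Fin r → ℕ} {q : Fin r → ℕ → K} (hq : ∀ i j, P i < j → q i j = 0) (hqP : ∀ i, q i (P i) ≠ 0) (hkP : ∀ i, k + P i ≤ n)
    {P' : Fin s → ℕ} {q' : Fin s → ℕ → K} (hq' : ∀ i j, P' i < j → q' i j = 0) (hqP' : ∀ i, q' i (P' i) ≠ 0) (hkP' : ∀ i, k + P' i ≤ n)
    (hD : (∑ i, (P i + 1)) + ∑ j, (P' j + 1) ≤ k + 1) (hr : 0 < r) (hs : 0 < s) {θ : HT K (In n)} (hθ : θ ∈ ⋀[K]^k (In n → K)) :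
    ∃ θA θB : HT K (In n), (∀ i, θA * w K n n (expMul K (lam i) (q i)) = 0) ∧ (∀ j, θB * w K n n (expMul K (nu j) (q' j)) = 0) ∧ θA + θB = θ := by
  rw [← Hom_univ_eq_exteriorPower, ← iInf_Kr_sup_iInf_Kr_eq_Hom K hlam hnu hdis hq hqP hkP hq' hqP' hkP' hD hr hs] at hθ
  obtain ⟨a, ha, b, hb, hab⟩ := Submodule.mem_sup.mp hθ
  rw [Submodule.mem_iInf] at ha hb
  exact ⟨a, b, fun i => (mem_Kr.mp (ha i)).2, fun j => (mem_Kr.mp (hb j)).2, hab⟩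

/-! ## §117. Union ↦ intersection; total order `≥ k + 1` ↦ the Siegel ideal -/

/-- **`(⋂_A Kr) ⊓ (⋂_B Kr) = SI_k` whenever `D_A + D_B ≥ k + 1`** (disjoint node sets, distinct nodes, exact orders with `k + P ≤ n`; G4 on `A ∪ B`). -/
theorem iInf_Kr_inf_iInf_Kr_eq_siegelIdeal {k r s : ℕ} {lam : Fin r → K} (hlam : Function.Injective lam) {nu : Fin s → K} (hnu : Function.Injective nu) (hdis : ∀ i j, lam i ≠ nu j)
    {P : Fin r → ℕ} {q : Fin r → ℕ → K} (hq : ∀ i j, P i < j → q i j = 0) (hqP : ∀ i, q i (P i) ≠ 0) (hkP : ∀ i, k + P i ≤ n)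
    {P' : Fin s → ℕ} {q' : Fin s → ℕ → K} (hq' : ∀ i j, P' i < j → q' i j = 0) (hqP' : ∀ i, q' i (P' i) ≠ 0) (hkP' : ∀ i, k + P' i ≤ n)
    (hD : k + 1 ≤ (∑ i, (P i + 1)) + ∑ j, (P' j + 1)) :
    (⨅ i, Kr K Finset.univ (w K n n (expMul K (lam i) (q i))) k) ⊓ (⨅ j, Kr K Finset.univ (w K n n (expMul K (nu j) (q' j))) k) = siegelIdeal K n k := by
  have happ : Function.Injective (Fin.append lam nu) := Fin.append_injective_iff.mpr ⟨hlam, hnu, hdis⟩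
  have hkPP : ∀ i : Fin (r + s), k + Fin.append P P' i ≤ n := fun i =>
    Fin.addCases (fun i => by rw [Fin.append_left]; exact hkP i) (fun i => by rw [Fin.append_right]; exact hkP' i) i
  rw [← iInf_Kr_append, iInf_Kr_w_expMul_eq_siegelIdeal' K happ (append_order_zero K hq hq') (append_order_ne K hqP hqP') hkPP (by rw [sum_order_append]; exact hD)]

/-- **AT `D_A + D_B = k + 1` THE TWO INTERSECTIONS ARE COMPLEMENTS MODULO `SI_k`**: their sum is `Hom(univ, k)` and their intersection is `SI_k`. -/
theorem iInf_Kr_isCompl_mod_siegelIdeal {k r s : ℕ} {lam : Fin r → K} (hlam : Function.Injective lam) {nu : Fin s → K} (hnu : Function.Injective nu) (hdis : ∀ i j, lam i ≠ nu j)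
    {P : Fin r → ℕ} {q : Fin r → ℕ → K} (hq : ∀ i j, P i < j → q i j = 0) (hqP : ∀ i, q i (P i) ≠ 0) (hkP : ∀ i, k + P i ≤ n)
    {P' : Fin s → ℕ} {q' : Fin s → ℕ → K} (hq' : ∀ i j, P' i < j → q' i j = 0) (hqP' : ∀ i, q' i (P' i) ≠ 0) (hkP' : ∀ i, k + P' i ≤ n)
    (hD : (∑ i, (P i + 1)) + ∑ j, (P' j + 1) = k + 1) (hr : 0 < r) (hs : 0 < s) :
    (⨅ i, Kr K Finset.univ (w K n n (expMul K (lam i) (q i))) k) ⊔ (⨅ j, Kr K Finset.univ (w K n n (expMul K (nu j) (q' j))) k) = Hom K (In n) Finset.univ k ∧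
      (⨅ i, Kr K Finset.univ (w K n n (expMul K (lam i) (q i))) k) ⊓ (⨅ j, Kr K Finset.univ (w K n n (expMul K (nu j) (q' j))) k) = siegelIdeal K n k :=
  ⟨iInf_Kr_sup_iInf_Kr_eq_Hom K hlam hnu hdis hq hqP hkP hq' hqP' hkP' hD.le hr hs, iInf_Kr_inf_iInf_Kr_eq_siegelIdeal K hlam hnu hdis hq hqP hkP hq' hqP' hkP' hD.ge⟩

end Summit.Ventures.HSemireg.Wedge.KernelDuality
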